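import Literature.MathematicalPhysics.QuantumFieldTheory.Federbush1986.PeelingObservation
import Literature.MathematicalPhysics.QuantumFieldTheory.Federbush1986.PureAveragesSU2

/-!
# Federbush [F3] §5.3 2)–3) p. 303 made QUANTITATIVE: in a peelable (axial, comb) gauge the bond variables are LIPSCHITZ in the
# plaquette variables, for every group with a bi-invariant metric — Bałaban's axial-gauge bound
# «|V₀(x, x + e_μ) − 1| < (|x₁ − y₁| + … + |x_{μ−1} − y_{μ−1}|) α₀» [Balaban1985Averaging (44)–(46)] in [F3]'s comb

statement-level skeleton of published theorems with citation tags; proofs where landed; nothing here is a claim about the Yang–Mills mass gap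

SOURCES.  [Federbush1987PhaseCellIII] P. Federbush, *A phase cell approach to Yang–Mills theory III. Local stability, modified
renormalization group transformation*, Commun. Math. Phys. **110** (1987) 293–309 (held `paper:url-4700a514f365`, pp. 299, 302–303 =
PDF pp. 7, 10–11): §5.1 p. 299 *«We define |g| = d(ε, g). … Lemma 5.1. |g₁g₂| ≦ |g₁| + |g₂| (5.2) … Lemma 5.3. |g| = |g⁻¹| (5.6) …
by invariance of the metric»*; §5.3 2)–3) p. 303 *«Observation. In a simply connected lattice, if the bonds in a maximal tree are
assigned the identity as a choice of gauge, then the bond variables are uniquely determined by the plaquette variables. 3) The bonds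
assigned ε inside a block in the Balaban axial gauge will also be assigned ε in the nice block sublattice. … We assign ε to a
sufficient number of additional bonds to define an axial gauge in each nice block.»*; §5.2 p. 302 *«We now work in a Balaban axial
gauge. … By the inverse function theorem we have for A_{∂p_i} small enough (depending on N), |A_{b_α} − Σ_i N_{αi}A_{∂p_i}| <
cΣ|A_{∂p_i}|². (5.24)  This estimate will enable us to control all corrections to steps in the small field proof.»*
[Balaban1985Averaging] T. Bałaban, *Averaging operations for lattice gauge theories*, Commun. Math. Phys. **98** (1985) 17–51 (held
`paper:balaban1985-cmp98-averaging`, pp. 24–25 = PDF pp. 8–9, text layer + the verbatim transcription of the tree's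
`Balaban1983to89/T4AxialChain` header): *«We assume that a configuration V defined on a unit lattice Ω′ satisfies |V(∂p′) − 1| < α₀,
p ⊂ Ω′, (44) … let us introduce locally the axial gauge with the initial point y. This means that we take the contours Γ_{y,x} …
and we make a gauge transformation v₀ such that the gauge transformed configuration V₀ = V^{v₀} satisfies the conditions
V₀(Γ_{y,x}) = 1. … |V₀(∂p) − 1| = |V(∂p) − 1| < α₀ (45) … The conditions V₀(Γ_{y,x}) = 1 imply V₀(x, x + e₁) = 1,
|V₀(x, x + e₂) − 1| < |x₁ − y₁|α₀, …, |V₀(x, x + e_μ) − 1| < (|x₁ − y₁| + … + |x_{μ−1} − y_{μ−1}|)α₀, μ = 2, …, d, for x in the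
neighborhood of y. … then for b ⊂ Δ(p′) we have |V₀,b − 1| < |b₋ − y|α₀ ≦ dLα₀ (46)»*.

CITATION HEADER (lean-in-tree rule).  lit-balaban cell (HOME `run/shared/lean/pub/lit-balaban/`), Phase-2 proof seat p26 (gen 11;
free-target protocol G.5-34(d), TAKING HOME/STATUS 2026-08-22T02:34Z), SKELETON row **F3.Eq5.26-5.40** (§5.3; owner r17, referee
ref-5, head `absent`) with a cross-reference to row F3.Eq5.24.  Fourth file of this seat's Observation thread
(`ObservationNonabelianWitness` p310996, `CombGaugeObservation` p312224, `ObservationNonabelianEmbeddings` p312960/p313788,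
`PeelingObservation` p313427/p314483): there the Observation is an EQUALITY statement (equal plaquette variables ⇒ equal bond
variables, from a peeling); here it is made METRIC.  Companions BY NAME (none edited): p32's `AxialGaugeEq524SU2` /
`AxialGaugeEq524Block` ((5.22)–(5.24) for `G = SU(2)` at the Lie-algebra level, small fields, iterated BCH), the tree's
`Balaban1983to89.T4AxialChain` / `B15TreeGaugeT0` (the same count in Bałaban's normed-algebra vocabulary `‖V − 1‖`), [F3] §5.1's
`absG` / `abs_mul_le` / `abs_inv` (`PureAverages`, r17).

WHAT IS PROVED (generic lattice `ℤ^d`, every `d`; EVERY group `G` with a distance invariant under left and right translations —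
[F3] §5.1's standing assumption «by invariance of the metric», `[IsIsometricSMul G G] [IsIsometricSMul Gᵐᵒᵖ G]`; NO small-field
hypothesis anywhere):
* §1 bookkeeping of Lemmas 5.0–5.3: `dist_mul_mul_le'` (`d(g₁g₂, g₁′g₂′) ≦ d(g₁, g₁′) + d(g₂, g₂′)`), `dist_mul₄_le`.
* §2 `otherSides z μ ν b` (the three sides of the square `(z; μ, ν)` other than `b`, computed in the four positions) and
  **`dist_side_le`**: for any side `b` of a genuine square, `d(u_b, u′_b) ≦ d(g_{∂p}(u), g_{∂p}(u′)) + Σ_{s ∈ other sides} d(u_s, u′_s)`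
  — the metric form of «one plaquette with three known sides determines the fourth» (`PeelingObservation.eq_of_plaq_eq_side`).
* §3 **`Peeling.dist_le_of_weight`** — THE PEELING ESTIMATE: given a peeling `π` of `(P, Λ, T)`, two configurations `u, u′` equal to
  `ε` on `T`, plaquette discrepancies `d(g_{∂p}(u), g_{∂p}(u′)) ≦ β(p)` on `P`, and weights `W ≧ 0` on `T` with
  `β(p(b)) + Σ_{other sides s of p(b)} W(s) ≦ W(b)` for every non-tree `b ∈ Λ`: `d(u_b, u′_b) ≦ W(b)` on `Λ` (induction on the rank,
  one attached plaquette at a time).  With `u′ ≡ ε`: `Peeling.absG_le_of_weight` (`|u_b| ≦ W(b)` from `|g_{∂p}| ≦ β(p)`).  The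
  equality statement `Peeling.eq_of_plaq_eq` is the case `β ≡ 0, W ≡ 0` (`Peeling.eq_of_plaq_eq'`, re-derived).
* §4 THE COMB (Bałaban's axial gauge of a box `[lo, hi]` with initial point the corner `lo`; [F3] step 3)): the weight is the HEIGHT
  `height lo ⟨x, x + e_μ⟩ = Σ_{ν > μ} (x_ν − lo_ν)` of `CombGaugeObservation` (`comb_weight_step`: across the attached plaquette the
  two `e_ν`-sides are comb bonds of height `0` and the fourth side has height one less), whence
  **`dist_le_height_mul_of_combGauge`**: `d(u_b, u′_b) ≦ height(b) · α` for comb-gauged `u, u′` whose plaquette variables are within `α`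
  of each other on the box — the Observation p. 303 as a LIPSCHITZ statement, constant `height(b) ≦ Σ_ν (hi_ν − lo_ν)`
  (`height_le_sum`); and with `u′ ≡ ε` Bałaban's (45)–(46) verbatim up to his ordering of the directions (his contours run along `e_d`
  first, ours along `e_1` first) — **`absG_le_height_mul_of_combGauge`**: `|g_{∂p}| ≦ α₀` on the box ⇒
  `|u⟨x, x + e_μ⟩| ≦ (Σ_{ν > μ} (x_ν − lo_ν)) · α₀`, and `absG_le_diam_mul_of_combGauge`: `≦ (Σ_ν (hi_ν − lo_ν)) · α₀` ((46): `≦ dLα₀`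
  on a cube of side `L`).
* §5 the same on STAIRCASES (unions of boxes with the common corner `lo`, `PeelingObservation.staircasePeeling`):
  `dist_le_height_mul_of_staircase`.
* §6 [F3]'s own `G = SU(2)` (r17's `SU2` with its bi-invariant distance of §1 p. 294, `PureAveragesSU2`) is an instance:
  `dist_le_height_mul_of_combGauge_SU2`, `absG_le_height_mul_of_combGauge_SU2`.
* §7 (v1.1) EVERY PEELING GIVES A LIPSCHITZ CONSTANT depending only on the lattice («A number of constants arise … we may choose the
  constants … by maximizing or minimizing over a finite set», p. 303): `length_otherSides` (= 3), **`Peeling.dist_le_pow_rank`**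
  (`d(u_b, u′_b) ≦ ((3^{rank(b)+1} − 1)/2) · α` — the weight `W = 0` on the tree, `(3^{rank+1} − 1)/2 · α` off it, satisfies §3's condition
  since a plaquette has three other sides), `Peeling.absG_le_pow_rank`.

HONEST SCOPE.  (a) [F3]'s (5.24) is a SECOND-order statement about Lie-algebra variables in a small field («by the inverse function
theorem»); this file proves the group-level Lipschitz bound that precedes it, globally, and does not touch (5.22)–(5.24) themselves
(rows F3.Eq5.22-5.23 / F3.Eq5.24, p32's files).  (b) Bałaban states (45)–(46) for unitary matrices with the operator norm
`|V − 1|`; the operator-norm distance on `U(N)` is bi-invariant, so his setting is an instance, but no `U(N)` instance is constructed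
here (the tree's `Balaban1983to89.T4AxialChain.norm_prod_sub_one_le_sum` is the normed-algebra form of the same count).  (c) The
weights/peeling formulation is this formalisation's (the located mechanism), not a printed statement.  One `def` with body
(`otherSides`); everything else is a theorem; no `sorry`, axioms standard.  Unit `lit-balaban-p26` (literature-prover-lit-balaban-p26-g11-0).

Versions: v1 p315145 (§1–§6); v1.1 (this text) = v1 unchanged + §7.
-/

namespace Literature.MathematicalPhysics.QuantumFieldTheory.Federbush1986

namespace PeelingObservation

open LatticeContour SimplyConnectedBox CombGaugeObservation

variable {d : ℕ}

/-! ## §1 Bookkeeping with a bi-invariant distance ([F3] §5.1 Lemmas 5.0–5.3) -/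

section Metric

variable {G : Type*} [Group G] [MetricSpace G] [IsIsometricSMul G G] [IsIsometricSMul Gᵐᵒᵖ G]

/-- `d(g₁g₂, g₁′g₂′) ≦ d(g₁, g₁′) + d(g₂, g₂′)` — Lemma 5.1's triangle step with both invariances of the metric.
[cite: Federbush1987PhaseCellIII, Lemmas 5.0–5.1 (5.1)–(5.4) p. 299] -/
theorem dist_mul_mul_le' (a b a' b' : G) : dist (a * b) (a' * b') ≤ dist a a' + dist b b' :=
  calc dist (a * b) (a' * b') ≤ dist (a * b) (a * b') + dist (a * b') (a' * b') := dist_triangle _ _ _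
    _ = dist b b' + dist a a' := by rw [dist_mul_left, dist_mul_right]
    _ = dist a a' + dist b b' := add_comm _ _

/-- Four factors: `d(abce, a′b′c′e′) ≦ d(a,a′) + d(b,b′) + d(c,c′) + d(e,e′)`. [cite: Federbush1987PhaseCellIII, Lemma 5.1 (5.2) p. 299] -/
theorem dist_mul₄_le (a b c e a' b' c' e' : G) :
    dist (a * b * c * e) (a' * b' * c' * e') ≤ dist a a' + dist b b' + dist c c' + dist e e' :=
  calc dist (a * b * c * e) (a' * b' * c' * e') ≤ dist (a * b * c) (a' * b' * c') + dist e e' := dist_mul_mul_le' _ _ _ _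
    _ ≤ dist (a * b) (a' * b') + dist c c' + dist e e' := by have := dist_mul_mul_le' (a * b) c (a' * b') c'; linarith
    _ ≤ dist a a' + dist b b' + dist c c' + dist e e' := by have := dist_mul_mul_le' a b a' b'; linarith

end Metric

/-! ## §2 One plaquette: the fourth side is Lipschitz in the plaquette variable and the other three sides -/

/-- The sides of the square `(z; μ, ν)` other than `b` (three of them when `b` is a side of a genuine square).
[cite: Federbush1987PhaseCellIII, (5.9)–(5.10) Fig. 6 p. 300] -/
def otherSides (z : Site d) (μ ν : Fin d) (b : Bond d) : List (Bond d) :=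
  ((plaqLoop z μ ν).map Prod.fst).filter (fun s => s ≠ b)

/-- Membership in `otherSides`: a side of the square different from `b`. [cite: Federbush1987PhaseCellIII, (5.9)–(5.10) p. 300] -/
theorem mem_otherSides_iff {z : Site d} {μ ν : Fin d} {b s : Bond d} :
    s ∈ otherSides z μ ν b ↔ (∃ l ∈ plaqLoop z μ ν, l.1 = s) ∧ s ≠ b := by
  simp only [otherSides, List.mem_filter, List.mem_map, decide_eq_true_eq]

section Sides

variable (z : Site d) {μ ν : Fin d} (hμν : μ ≠ ν)
include hμν

/-- The other sides of the first side `⟨z, z + e_μ⟩`. [cite: Federbush1987PhaseCellIII, (5.9)–(5.10) p. 300] -/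
theorem otherSides_first : otherSides z μ ν (z, μ) = [(z + ev μ, ν), (z + ev ν, μ), (z, ν)] := by
  have h1 : ((z + ev μ, ν) : Bond d) ≠ (z, μ) := fun h => hμν.symm (congrArg Prod.snd h)
  have h2 : ((z + ev ν, μ) : Bond d) ≠ (z, μ) := fun h => add_ev_ne z ν (congrArg Prod.fst h)
  have h3 : ((z, ν) : Bond d) ≠ (z, μ) := fun h => hμν.symm (congrArg Prod.snd h)
  simp only [otherSides, plaqLoop, List.map_cons, List.map_nil]
  rw [List.filter_cons_of_neg (by simp), List.filter_cons_of_pos (by exact decide_eq_true h1),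
    List.filter_cons_of_pos (by exact decide_eq_true h2), List.filter_cons_of_pos (by exact decide_eq_true h3), List.filter_nil]

/-- The other sides of the second side `⟨z + e_μ, z + e_μ + e_ν⟩`. [cite: Federbush1987PhaseCellIII, (5.9)–(5.10) p. 300] -/
theorem otherSides_second : otherSides z μ ν (z + ev μ, ν) = [(z, μ), (z + ev ν, μ), (z, ν)] := by
  have h1 : ((z, μ) : Bond d) ≠ (z + ev μ, ν) := fun h => hμν (congrArg Prod.snd h)
  have h2 : ((z + ev ν, μ) : Bond d) ≠ (z + ev μ, ν) := fun h => hμν (congrArg Prod.snd h)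
  have h3 : ((z, ν) : Bond d) ≠ (z + ev μ, ν) := fun h => (add_ev_ne z μ) (congrArg Prod.fst h).symm
  simp only [otherSides, plaqLoop, List.map_cons, List.map_nil]
  rw [List.filter_cons_of_pos (by exact decide_eq_true h1), List.filter_cons_of_neg (by simp),
    List.filter_cons_of_pos (by exact decide_eq_true h2), List.filter_cons_of_pos (by exact decide_eq_true h3), List.filter_nil]

/-- The other sides of the third side `⟨z + e_ν, z + e_μ + e_ν⟩`. [cite: Federbush1987PhaseCellIII, (5.9)–(5.10) p. 300] -/
theorem otherSides_third : otherSides z μ ν (z + ev ν, μ) = [(z, μ), (z + ev μ, ν), (z, ν)] := by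
  have h1 : ((z, μ) : Bond d) ≠ (z + ev ν, μ) := fun h => (add_ev_ne z ν) (congrArg Prod.fst h).symm
  have h2 : ((z + ev μ, ν) : Bond d) ≠ (z + ev ν, μ) := fun h => hμν.symm (congrArg Prod.snd h)
  have h3 : ((z, ν) : Bond d) ≠ (z + ev ν, μ) := fun h => hμν.symm (congrArg Prod.snd h)
  simp only [otherSides, plaqLoop, List.map_cons, List.map_nil]
  rw [List.filter_cons_of_pos (by exact decide_eq_true h1), List.filter_cons_of_pos (by exact decide_eq_true h2),
    List.filter_cons_of_neg (by simp), List.filter_cons_of_pos (by exact decide_eq_true h3), List.filter_nil]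

/-- The other sides of the fourth side `⟨z, z + e_ν⟩`. [cite: Federbush1987PhaseCellIII, (5.9)–(5.10) p. 300] -/
theorem otherSides_fourth : otherSides z μ ν (z, ν) = [(z, μ), (z + ev μ, ν), (z + ev ν, μ)] := by
  have h1 : ((z, μ) : Bond d) ≠ (z, ν) := fun h => hμν (congrArg Prod.snd h)
  have h2 : ((z + ev μ, ν) : Bond d) ≠ (z, ν) := fun h => add_ev_ne z μ (congrArg Prod.fst h)
  have h3 : ((z + ev ν, μ) : Bond d) ≠ (z, ν) := fun h => hμν (congrArg Prod.snd h)
  simp only [otherSides, plaqLoop, List.map_cons, List.map_nil]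
  rw [List.filter_cons_of_pos (by exact decide_eq_true h1), List.filter_cons_of_pos (by exact decide_eq_true h2),
    List.filter_cons_of_pos (by exact decide_eq_true h3), List.filter_cons_of_neg (by simp), List.filter_nil]

end Sides

section OnePlaquette

variable {G : Type*} [Group G] [MetricSpace G] [IsIsometricSMul G G] [IsIsometricSMul Gᵐᵒᵖ G]

/-- **One plaquette, three sides (metric form).**  For any side `b` of the genuine square `p = (z; μ, ν)`,
`d(u_b, u′_b) ≦ d(g_{∂p}(u), g_{∂p}(u′)) + Σ_{s ∈ other three sides} d(u_s, u′_s)`: the fourth side is a word in `g_{∂p}^{±1}` and the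
other three sides (`g_{∂p} = u₁u₂u₃⁻¹u₄⁻¹` solved for each letter), and Lemmas 5.1, 5.3 bound the word.
[cite: Federbush1987PhaseCellIII, Lemma 5.1 (5.2), Lemma 5.3 (5.6) p. 299; (5.11) p. 300; §5.3 2) Observation p. 303] -/
theorem dist_side_le (u u' : Bond d → G) {z : Site d} {μ ν : Fin d} (hμν : μ ≠ ν) {b : Bond d}
    (hb : ∃ l ∈ plaqLoop z μ ν, l.1 = b) :
    dist (u b) (u' b) ≤ dist (wordHol u (plaqLoop z μ ν)) (wordHol u' (plaqLoop z μ ν)) +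
      ((otherSides z μ ν b).map fun s => dist (u s) (u' s)).sum := by
  -- the four letters of `g_{∂p}` for `u` and `u'`
  set A := u (z, μ) with hA
  set B := u (z + ev μ, ν) with hB
  set C := u (z + ev ν, μ) with hC
  set D := u (z, ν) with hD
  set A' := u' (z, μ) with hA'
  set B' := u' (z + ev μ, ν) with hB'
  set C' := u' (z + ev ν, μ) with hC'
  set D' := u' (z, ν) with hD'
  set H := wordHol u (plaqLoop z μ ν) with hH
  set H' := wordHol u' (plaqLoop z μ ν) with hH'
  have hHe : H = A * B * C⁻¹ * D⁻¹ := by rw [hH, wordHol_plaqLoop]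
  have hHe' : H' = A' * B' * C'⁻¹ * D'⁻¹ := by rw [hH', wordHol_plaqLoop]
  rcases mem_plaqLoop_iff.1 hb with rfl | rfl | rfl | rfl
  · -- first side: `A = H·D·C·B⁻¹`
    rw [otherSides_first z hμν]
    simp only [List.map_cons, List.map_nil, List.sum_cons, List.sum_nil, add_zero]
    have e : A = H * D * C * B⁻¹ := by rw [hHe]; group
    have e' : A' = H' * D' * C' * B'⁻¹ := by rw [hHe']; group
    rw [← hA, ← hA', e, e']
    have := dist_mul₄_le H D C B⁻¹ H' D' C' B'⁻¹
    rw [dist_inv_inv] at this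
    rw [← hB, ← hB', ← hC, ← hC', ← hD, ← hD']
    linarith
  · -- second side: `B = A⁻¹·H·D·C`
    rw [otherSides_second z hμν]
    simp only [List.map_cons, List.map_nil, List.sum_cons, List.sum_nil, add_zero]
    have e : B = A⁻¹ * H * D * C := by rw [hHe]; group
    have e' : B' = A'⁻¹ * H' * D' * C' := by rw [hHe']; group
    rw [← hB, ← hB', e, e']
    have := dist_mul₄_le A⁻¹ H D C A'⁻¹ H' D' C'
    rw [dist_inv_inv] at this
    rw [← hA, ← hA', ← hC, ← hC', ← hD, ← hD']
    linarith
  · -- third side: `C = D⁻¹·H⁻¹·A·B`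
    rw [otherSides_third z hμν]
    simp only [List.map_cons, List.map_nil, List.sum_cons, List.sum_nil, add_zero]
    have e : C = D⁻¹ * H⁻¹ * A * B := by rw [hHe]; group
    have e' : C' = D'⁻¹ * H'⁻¹ * A' * B' := by rw [hHe']; group
    rw [← hC, ← hC', e, e']
    have := dist_mul₄_le D⁻¹ H⁻¹ A B D'⁻¹ H'⁻¹ A' B'
    rw [dist_inv_inv, dist_inv_inv] at this
    rw [← hA, ← hA', ← hB, ← hB', ← hD, ← hD']
    linarith
  · -- fourth side: `D = H⁻¹·A·B·C⁻¹`
    rw [otherSides_fourth z hμν]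
    simp only [List.map_cons, List.map_nil, List.sum_cons, List.sum_nil, add_zero]
    have e : D = H⁻¹ * A * B * C⁻¹ := by rw [hHe]; group
    have e' : D' = H'⁻¹ * A' * B' * C'⁻¹ := by rw [hHe']; group
    rw [← hD, ← hD', e, e']
    have := dist_mul₄_le H⁻¹ A B C⁻¹ H'⁻¹ A' B' C'⁻¹
    rw [dist_inv_inv, dist_inv_inv] at this
    rw [← hA, ← hA', ← hB, ← hB', ← hC, ← hC']
    linarith

end OnePlaquette

/-! ## §3 The peeling estimate: bond variables are Lipschitz in the plaquette variables -/

section Estimate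

variable {G : Type*} [Group G] [MetricSpace G] [IsIsometricSMul G G] [IsIsometricSMul Gᵐᵒᵖ G]
variable {P : Set (LatticeContour.Plaq d)} {Λ T : Set (Bond d)}

/-- **The peeling estimate.**  Let `π` peel `Λ` relative to `(T, P)`, let `u, u′` be `ε` on `T` with plaquette variables within `β(p)`
of each other on `P`, and let `W` be weights, non-negative on `T`, with `β(p(b)) + Σ_{other sides s of p(b)} W(s) ≦ W(b)` for every
non-tree `b ∈ Λ`.  Then `d(u_b, u′_b) ≦ W(b)` on `Λ`: «the bond variables are uniquely determined by the plaquette variables» —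
Lipschitz-continuously, one attached plaquette at a time (induction on the rank).
[cite: Federbush1987PhaseCellIII, §5.3 2)–3) Observation p. 303; Lemmas 5.1, 5.3 p. 299] -/
theorem Peeling.dist_le_of_weight (π : Peeling P Λ T) (u u' : Bond d → G) (hg : ∀ b ∈ T, u b = 1) (hg' : ∀ b ∈ T, u' b = 1)
    (β : LatticeContour.Plaq d → ℝ)
    (hβ : ∀ p ∈ P, dist (wordHol u (plaqLoop p.1 p.2.1 p.2.2)) (wordHol u' (plaqLoop p.1 p.2.1 p.2.2)) ≤ β p)
    (W : Bond d → ℝ) (hWT : ∀ b ∈ T, 0 ≤ W b)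
    (hW : ∀ b ∈ Λ, b ∉ T →
      β (π.plaq b) + ((otherSides (π.plaq b).1 (π.plaq b).2.1 (π.plaq b).2.2 b).map W).sum ≤ W b) :
    ∀ b ∈ Λ, dist (u b) (u' b) ≤ W b := by
  have key : ∀ n : ℕ, ∀ b ∈ Λ, π.rank b < n → dist (u b) (u' b) ≤ W b := by
    intro n
    induction n with
    | zero => intro b _ h; omega
    | succ n ih =>
      intro b hb hn
      by_cases hT : b ∈ T
      · rw [hg b hT, hg' b hT, dist_self]; exact hWT b hT
      · refine (dist_side_le u u' (π.plaq_ne b hb hT) (π.mem_plaq b hb hT)).trans ((add_le_add (hβ _ (π.plaq_mem b hb hT))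
          (List.sum_le_sum fun s hs => ?_)).trans (hW b hb hT))
        obtain ⟨⟨l, hl, rfl⟩, hne⟩ := mem_otherSides_iff.1 hs
        rcases π.lower b hb hT l hl hne with h | ⟨hΛ, hlt⟩
        · rw [hg _ h, hg' _ h, dist_self]; exact hWT _ h
        · exact ih _ hΛ (by omega)
  exact fun b hb => key _ b hb (Nat.lt_succ_self _)

/-- **The peeling estimate, small-field form** (`u′ ≡ ε`): `|g_{∂p}| ≦ β(p)` on `P` and `ε` on `T` give `|u_b| ≦ W(b)` on `Λ` for weights as
above. [cite: Federbush1987PhaseCellIII, §5.3 2)–3) Observation p. 303; §5.1 p. 299] -/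
theorem Peeling.absG_le_of_weight (π : Peeling P Λ T) (u : Bond d → G) (hg : ∀ b ∈ T, u b = 1)
    (β : LatticeContour.Plaq d → ℝ) (hβ : ∀ p ∈ P, absG (wordHol u (plaqLoop p.1 p.2.1 p.2.2)) ≤ β p)
    (W : Bond d → ℝ) (hWT : ∀ b ∈ T, 0 ≤ W b)
    (hW : ∀ b ∈ Λ, b ∉ T →
      β (π.plaq b) + ((otherSides (π.plaq b).1 (π.plaq b).2.1 (π.plaq b).2.2 b).map W).sum ≤ W b) :
    ∀ b ∈ Λ, absG (u b) ≤ W b := by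
  intro b hb
  have h := π.dist_le_of_weight u (fun _ => 1) hg (fun _ _ => rfl) β (fun p hp => ?_) W hWT hW b hb
  · rwa [absG_def, dist_comm]
  · rw [wordHol_eq_one_of_forall (fun _ => (1 : G)) fun _ _ => rfl, dist_comm, ← absG_def]
    exact hβ p hp

/-- The equality statement back (`β ≡ 0`, `W ≡ 0`): equal plaquette variables on `P` and `ε` on `T` ⇒ equal on `Λ` — for groups with a
bi-invariant metric, `PeelingObservation.Peeling.eq_of_plaq_eq` re-derived from the estimate.
[cite: Federbush1987PhaseCellIII, §5.3 2)–3) Observation p. 303] -/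
theorem Peeling.eq_of_plaq_eq' (π : Peeling P Λ T) (u u' : Bond d → G) (hg : ∀ b ∈ T, u b = 1) (hg' : ∀ b ∈ T, u' b = 1)
    (hplaq : ∀ p ∈ P, wordHol u (plaqLoop p.1 p.2.1 p.2.2) = wordHol u' (plaqLoop p.1 p.2.1 p.2.2)) :
    ∀ b ∈ Λ, u b = u' b := fun b hb =>
  dist_le_zero.1 (π.dist_le_of_weight u u' hg hg' (fun _ => 0) (fun p hp => by rw [hplaq p hp, dist_self]) (fun _ => 0)
    (fun _ _ => le_rfl) (fun _ _ _ => by simp) b hb)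

end Estimate

/-! ## §4 The comb: Bałaban's axial-gauge bound, linear in the height -/

section Comb

variable {lo hi : Site d}

/-- **One step down the comb, with weights.**  For a non-comb bond `b = ⟨x, x + e_μ⟩` of the box with top direction `ν`, the attached
plaquette `(x − e_ν; μ, ν)` has as other sides the bond `⟨x − e_ν, x − e_ν + e_μ⟩` of height `height(b) − 1` and two comb bonds (height
`0`), so the weight `W = height · α` satisfies `α + Σ_{other sides} W = W(b)`.
[cite: Federbush1987PhaseCellIII, §5.3 2)–3) p. 303; Balaban1985Averaging, (45) p. 24] -/
theorem comb_weight_step {x : Site d} {μ : Fin d} (hb : ((x, μ) : Bond d) ∈ boxBonds lo hi)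
    (hT : ((x, μ) : Bond d) ∉ combTree lo hi) (α : ℝ) :
    α + ((otherSides (combPlaq lo (x, μ)).1 (combPlaq lo (x, μ)).2.1 (combPlaq lo (x, μ)).2.2 (x, μ)).map
      fun s => (height lo s : ℝ) * α).sum = (height lo ((x, μ) : Bond d) : ℝ) * α := by
  have h0 : height lo ((x, μ) : Bond d) ≠ 0 := fun h0 => hT (mem_combTree_of_height_eq_zero hb h0)
  obtain ⟨ν, hp, hμν, hne, htop⟩ := combPlaq_spec h0
  have hν : lo ν < x ν := lt_of_le_of_ne (mem_boxSites.1 (fst_mem_boxSites hb) ν).1 (Ne.symm hne)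
  have hsides : otherSides (x - ev ν) μ ν (x, μ) = [(x - ev ν, μ), (x - ev ν + ev μ, ν), (x - ev ν, ν)] := by
    have := otherSides_third (x - ev ν) (ne_of_lt hμν)
    rwa [sub_ev_add_ev] at this
  rw [hp]
  dsimp only
  rw [hsides]
  simp only [List.map_cons, List.map_nil, List.sum_cons, List.sum_nil, add_zero]
  rw [height_eq_zero_of_mem_combTree (lowerShiftSide_mem_combTree hb hμν hν htop),
    height_eq_zero_of_mem_combTree (lowerSide_mem_combTree hb hν htop)]
  have hh : ((height lo ((x - ev ν, μ) : Bond d) : ℕ) : ℝ) + 1 = height lo ((x, μ) : Bond d) := by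
    exact_mod_cast height_lower lo hμν hν (x := x)
  rw [← hh]
  push_cast
  ring

variable {G : Type*} [Group G] [MetricSpace G] [IsIsometricSMul G G] [IsIsometricSMul Gᵐᵒᵖ G]

/-- **The Observation in the comb gauge, Lipschitz form, EVERY group with a bi-invariant metric.**  If `u, u′` are `ε` on the comb of the
box `[lo, hi]` and their plaquette variables are within `α` of each other on every plaquette of the box, then on every bond
`b = ⟨x, x + e_μ⟩` of the box `d(u_b, u′_b) ≦ height(b) · α`, `height(b) = Σ_{ν > μ} (x_ν − lo_ν)` — no small-field hypothesis.
[cite: Federbush1987PhaseCellIII, §5.3 2)–3) Observation p. 303; Balaban1985Averaging, (45)–(46) pp. 24–25] -/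
theorem dist_le_height_mul_of_combGauge (lo hi : Site d) (u u' : Bond d → G)
    (hg : ∀ b ∈ combTree lo hi, u b = 1) (hg' : ∀ b ∈ combTree lo hi, u' b = 1) {α : ℝ}
    (hα : ∀ p ∈ boxPlaq lo hi,
      dist (wordHol u (plaqLoop p.1 p.2.1 p.2.2)) (wordHol u' (plaqLoop p.1 p.2.1 p.2.2)) ≤ α) :
    ∀ b ∈ boxBonds lo hi, dist (u b) (u' b) ≤ height lo b * α := by
  refine (combPeeling lo hi).dist_le_of_weight u u' hg hg' (fun _ => α) hα (fun b => (height lo b : ℝ) * α)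
    (fun b hb => by rw [height_eq_zero_of_mem_combTree hb, Nat.cast_zero, zero_mul]) ?_
  rintro ⟨x, μ⟩ hb hT
  exact le_of_eq (comb_weight_step hb hT α)

/-- **Bałaban's axial-gauge bound (45), in [F3]'s comb.**  «The conditions V₀(Γ_{y,x}) = 1 imply … |V₀(x, x + e_μ) − 1| <
(|x₁ − y₁| + … + |x_{μ−1} − y_{μ−1}|)α₀» — here with initial point the corner `lo` and the directions in the opposite order (the
contours `Γ_{lo,x}` run along `e_1` first): if `u` is `ε` on the comb and `|g_{∂p}| ≦ α₀` on every plaquette of the box, then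
`|u⟨x, x + e_μ⟩| ≦ (Σ_{ν > μ} (x_ν − lo_ν)) · α₀` on every bond of the box; every group with a bi-invariant metric, no smallness of `α₀`
needed. [cite: Balaban1985Averaging, (44)–(45) p. 24; Federbush1987PhaseCellIII, §5.3 2)–3) p. 303] -/
theorem absG_le_height_mul_of_combGauge (lo hi : Site d) (u : Bond d → G) (hg : ∀ b ∈ combTree lo hi, u b = 1) {α₀ : ℝ}
    (hα : ∀ p ∈ boxPlaq lo hi, absG (wordHol u (plaqLoop p.1 p.2.1 p.2.2)) ≤ α₀) :
    ∀ b ∈ boxBonds lo hi, absG (u b) ≤ height lo b * α₀ := by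
  refine (combPeeling lo hi).absG_le_of_weight u hg (fun _ => α₀) hα (fun b => (height lo b : ℝ) * α₀)
    (fun b hb => by rw [height_eq_zero_of_mem_combTree hb, Nat.cast_zero, zero_mul]) ?_
  rintro ⟨x, μ⟩ hb hT
  exact le_of_eq (comb_weight_step hb hT α₀)

omit [IsIsometricSMul G G] [IsIsometricSMul Gᵐᵒᵖ G] in
/-- The height of a bond of the box is at most `Σ_ν (hi_ν − lo_ν)` (`≦ dL` on a cube of side `L`).
[cite: Balaban1985Averaging, (46) p. 25] -/
theorem height_le_sum {b : Bond d} (hb : b ∈ boxBonds lo hi) : height lo b ≤ ∑ ν : Fin d, (hi ν - lo ν).toNat := by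
  unfold height
  refine Finset.sum_le_sum fun ν _ => ?_
  have hx := mem_boxSites.1 (mem_boxBonds.1 hb).1 ν
  by_cases hν : b.2 < ν
  · rw [if_pos hν]
    exact Int.toNat_le_toNat (by omega)
  · rw [if_neg hν]; exact Nat.zero_le _

/-- **(46): `|V₀,b − 1| < |b₋ − y|α₀ ≦ dLα₀`.**  In the comb gauge of the box `[lo, hi]`, `|g_{∂p}| ≦ α₀` on the box gives
`|u_b| ≦ (Σ_ν (hi_ν − lo_ν)) · α₀` on every bond of the box. [cite: Balaban1985Averaging, (46) p. 25; Federbush1987PhaseCellIII, §5.3 2)–3) p. 303] -/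
theorem absG_le_diam_mul_of_combGauge (lo hi : Site d) (u : Bond d → G) (hg : ∀ b ∈ combTree lo hi, u b = 1) {α₀ : ℝ}
    (hα₀ : 0 ≤ α₀) (hα : ∀ p ∈ boxPlaq lo hi, absG (wordHol u (plaqLoop p.1 p.2.1 p.2.2)) ≤ α₀) :
    ∀ b ∈ boxBonds lo hi, absG (u b) ≤ (∑ ν : Fin d, (hi ν - lo ν).toNat : ℕ) * α₀ := fun b hb =>
  (absG_le_height_mul_of_combGauge lo hi u hg hα b hb).trans
    (mul_le_mul_of_nonneg_right (by exact_mod_cast height_le_sum hb) hα₀)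

end Comb

/-! ## §5 Staircases -/

section Staircase

variable {ι : Sort*} {G : Type*} [Group G] [MetricSpace G] [IsIsometricSMul G G] [IsIsometricSMul Gᵐᵒᵖ G]

/-- The Lipschitz form of the Observation on every STAIRCASE of boxes with the common corner `lo`, in the union-of-combs gauge:
`d(u_b, u′_b) ≦ height(b) · α`. [cite: Federbush1987PhaseCellIII, §5.3 2)–3) Observation p. 303; Balaban1985Averaging, (45) p. 24] -/
theorem dist_le_height_mul_of_staircase (lo : Site d) (hi : ι → Site d) (u u' : Bond d → G)
    (hg : ∀ b ∈ ⋃ i, combTree lo (hi i), u b = 1) (hg' : ∀ b ∈ ⋃ i, combTree lo (hi i), u' b = 1) {α : ℝ}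
    (hα : ∀ p ∈ ⋃ i, boxPlaq lo (hi i),
      dist (wordHol u (plaqLoop p.1 p.2.1 p.2.2)) (wordHol u' (plaqLoop p.1 p.2.1 p.2.2)) ≤ α) :
    ∀ b ∈ ⋃ i, boxBonds lo (hi i), dist (u b) (u' b) ≤ height lo b * α := by
  refine (staircasePeeling lo hi).dist_le_of_weight u u' hg hg' (fun _ => α) hα (fun b => (height lo b : ℝ) * α)
    (fun b hb => ?_) ?_
  · obtain ⟨i, hi⟩ := Set.mem_iUnion.1 hb
    rw [height_eq_zero_of_mem_combTree hi, Nat.cast_zero, zero_mul]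
  · rintro ⟨x, μ⟩ hb hT
    obtain ⟨i, hbi⟩ := Set.mem_iUnion.1 hb
    exact le_of_eq (comb_weight_step hbi (fun h => hT (Set.mem_iUnion.2 ⟨i, h⟩)) α)

end Staircase

/-! ## §6 [F3]'s own group `G = SU(2)` -/

section SU2Instance

/-- In [F3]'s setting `G = SU(2)` (the unit quaternions with the bi-invariant distance of §1 p. 294, r17's `SU2`): two comb-gauged
`SU(2)`-configurations on a box whose plaquette variables are within `α` of each other agree within `height(b) · α` on every bond.
[cite: Federbush1987PhaseCellIII, §1 p. 294; §5.3 2)–3) Observation p. 303] -/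
theorem dist_le_height_mul_of_combGauge_SU2 (lo hi : Site d) (u u' : Bond d → SU2)
    (hg : ∀ b ∈ combTree lo hi, u b = 1) (hg' : ∀ b ∈ combTree lo hi, u' b = 1) {α : ℝ}
    (hα : ∀ p ∈ boxPlaq lo hi,
      dist (wordHol u (plaqLoop p.1 p.2.1 p.2.2)) (wordHol u' (plaqLoop p.1 p.2.1 p.2.2)) ≤ α) :
    ∀ b ∈ boxBonds lo hi, dist (u b) (u' b) ≤ height lo b * α :=
  dist_le_height_mul_of_combGauge lo hi u u' hg hg' hα

/-- … and Bałaban's (45) for `SU(2)`: `|g_{∂p}| ≦ α₀` on the box and `ε` on the comb ⇒ `|u⟨x, x + e_μ⟩| ≦ (Σ_{ν > μ} (x_ν − lo_ν)) · α₀`.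
[cite: Balaban1985Averaging, (45) p. 24; Federbush1987PhaseCellIII, §5.3 2)–3) p. 303] -/
theorem absG_le_height_mul_of_combGauge_SU2 (lo hi : Site d) (u : Bond d → SU2) (hg : ∀ b ∈ combTree lo hi, u b = 1)
    {α₀ : ℝ} (hα : ∀ p ∈ boxPlaq lo hi, absG (wordHol u (plaqLoop p.1 p.2.1 p.2.2)) ≤ α₀) :
    ∀ b ∈ boxBonds lo hi, absG (u b) ≤ height lo b * α₀ :=
  absG_le_height_mul_of_combGauge lo hi u hg hα

end SU2Instance

/-! ## §7 (v1.1) Every peeling gives a Lipschitz constant: `(3^{rank+1} − 1)/2` -/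

section RankBound

/-- A side of a genuine square has exactly three other sides. [cite: Federbush1987PhaseCellIII, (5.9)–(5.10) p. 300] -/
theorem length_otherSides {z : Site d} {μ ν : Fin d} (hμν : μ ≠ ν) {b : Bond d} (hb : ∃ l ∈ plaqLoop z μ ν, l.1 = b) :
    (otherSides z μ ν b).length = 3 := by
  rcases mem_plaqLoop_iff.1 hb with rfl | rfl | rfl | rfl
  · rw [otherSides_first z hμν]; rfl
  · rw [otherSides_second z hμν]; rfl
  · rw [otherSides_third z hμν]; rfl
  · rw [otherSides_fourth z hμν]; rfl

variable {G : Type*} [Group G] [MetricSpace G] [IsIsometricSMul G G] [IsIsometricSMul Gᵐᵒᵖ G]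
variable {P : Set (LatticeContour.Plaq d)} {Λ T : Set (Bond d)}

/-- The rank weight `w(r) = (3^{r+1} − 1)/2 · α` solves `α + 3·w(r − 1) = w(r)`, `w(0) = α`, and is monotone.
[cite: Federbush1987PhaseCellIII, §5.3 p. 303] -/
theorem rankWeight_step {α : ℝ} (hα : 0 ≤ α) {r s : ℕ} (hsr : s < r) :
    ((3 : ℝ) ^ (s + 1) - 1) / 2 * α ≤ (((3 : ℝ) ^ (r + 1) - 1) / 2 * α - α) / 3 := by
  have h3 : (3 : ℝ) ^ (s + 1) ≤ 3 ^ r := pow_le_pow_right₀ (by norm_num) (by omega)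
  have hr : (3 : ℝ) ^ (r + 1) = 3 * 3 ^ r := by rw [pow_succ]; ring
  rw [hr]
  have h1 : (1 : ℝ) ≤ 3 ^ (s + 1) := one_le_pow₀ (by norm_num)
  nlinarith

/-- **Every peeling gives a Lipschitz constant.**  For any peeling `π` of `(P, Λ, T)` and `u, u′` equal to `ε` on `T` with plaquette
variables within `α ≧ 0` of each other on `P`: `d(u_b, u′_b) ≦ ((3^{rank(b)+1} − 1)/2) · α` on `Λ` — a constant depending only on the
elimination order, i.e. on the lattice («we may choose the constants independent of l.f. plaquette positions by maximizing or minimizing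
over a finite set»). [cite: Federbush1987PhaseCellIII, §5.3 p. 303, 2)–3) Observation] -/
theorem Peeling.dist_le_pow_rank (π : Peeling P Λ T) (u u' : Bond d → G) (hg : ∀ b ∈ T, u b = 1) (hg' : ∀ b ∈ T, u' b = 1)
    {α : ℝ} (hα : 0 ≤ α)
    (hplaq : ∀ p ∈ P, dist (wordHol u (plaqLoop p.1 p.2.1 p.2.2)) (wordHol u' (plaqLoop p.1 p.2.1 p.2.2)) ≤ α) :
    ∀ b ∈ Λ, dist (u b) (u' b) ≤ ((3 : ℝ) ^ (π.rank b + 1) - 1) / 2 * α := by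
  classical
  -- the weight: `0` on the tree, `w(rank)` off it
  let W : Bond d → ℝ := fun b => if b ∈ T then 0 else ((3 : ℝ) ^ (π.rank b + 1) - 1) / 2 * α
  have hw0 : ∀ r : ℕ, 0 ≤ ((3 : ℝ) ^ (r + 1) - 1) / 2 * α := fun r =>
    mul_nonneg (div_nonneg (by linarith [one_le_pow₀ (M₀ := ℝ) (a := 3) (n := r + 1) (by norm_num)]) (by norm_num)) hα
  have hWle : ∀ b, W b ≤ ((3 : ℝ) ^ (π.rank b + 1) - 1) / 2 * α := fun b => by
    dsimp only [W]; split_ifs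
    · exact hw0 _
    · exact le_rfl
  intro b hb
  refine (π.dist_le_of_weight u u' hg hg' (fun _ => α) hplaq W (fun b hbT => by dsimp only [W]; rw [if_pos hbT]) ?_ b hb).trans
    (hWle b)
  intro b hb hbT
  dsimp only [W]
  rw [if_neg hbT]
  -- each of the three other sides weighs at most `(w(rank b) − α)/3`
  set c : ℝ := ((((3 : ℝ) ^ (π.rank b + 1) - 1) / 2 * α) - α) / 3 with hc
  have hc0 : 0 ≤ c := by
    rw [hc]
    have h1 : (1 : ℝ) ≤ 3 ^ π.rank b := one_le_pow₀ (by norm_num)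
    have hr : (3 : ℝ) ^ (π.rank b + 1) = 3 * 3 ^ π.rank b := by rw [pow_succ]; ring
    rw [hr]; nlinarith
  have hside : ∀ s ∈ otherSides (π.plaq b).1 (π.plaq b).2.1 (π.plaq b).2.2 b,
      (if s ∈ T then (0 : ℝ) else ((3 : ℝ) ^ (π.rank s + 1) - 1) / 2 * α) ≤ c := by
    intro s hs
    obtain ⟨⟨l, hl, rfl⟩, hne⟩ := mem_otherSides_iff.1 hs
    split_ifs with hsT
    · exact hc0
    · rcases π.lower b hb hbT l hl hne with h | ⟨-, hlt⟩
      · exact absurd h hsT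
      · rw [hc]; exact rankWeight_step hα hlt
  have hsum := List.sum_le_card_nsmul _ c (fun x hx => by
    obtain ⟨s, hs, rfl⟩ := List.mem_map.1 hx
    exact hside s hs)
  rw [List.length_map, length_otherSides (π.plaq_ne b hb hbT) (π.mem_plaq b hb hbT), nsmul_eq_mul] at hsum
  have : α + 3 * c = ((3 : ℝ) ^ (π.rank b + 1) - 1) / 2 * α := by rw [hc]; ring
  push_cast at hsum
  linarith

/-- The same with `u′ ≡ ε`: `|g_{∂p}| ≦ α` on `P` and `ε` on `T` ⇒ `|u_b| ≦ ((3^{rank(b)+1} − 1)/2) · α` on `Λ`.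
[cite: Federbush1987PhaseCellIII, §5.3 p. 303, 2)–3) Observation] -/
theorem Peeling.absG_le_pow_rank (π : Peeling P Λ T) (u : Bond d → G) (hg : ∀ b ∈ T, u b = 1) {α : ℝ} (hα : 0 ≤ α)
    (hplaq : ∀ p ∈ P, absG (wordHol u (plaqLoop p.1 p.2.1 p.2.2)) ≤ α) :
    ∀ b ∈ Λ, absG (u b) ≤ ((3 : ℝ) ^ (π.rank b + 1) - 1) / 2 * α := by
  intro b hb
  have h := π.dist_le_pow_rank u (fun _ => 1) hg (fun _ _ => rfl) hα (fun p hp => ?_) b hb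
  · rwa [absG_def, dist_comm]
  · rw [wordHol_eq_one_of_forall (fun _ => (1 : G)) fun _ _ => rfl, dist_comm, ← absG_def]
    exact hplaq p hp

end RankBound

end PeelingObservation

end Literature.MathematicalPhysics.QuantumFieldTheory.Federbush1986
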